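import Mathlib
import Summits.ValiantsHypothesis.ValiantsHypothesis.Theses.ChowBorderDepth3
import Summits.ValiantsHypothesis.ValiantsHypothesis.Theorems.ChowBorderDepth3ChowToThesis
import Summits.ValiantsHypothesis.ValiantsHypothesis.Theorems.ChowBorderDepth3BStableWitnessBoundRyserLocal
import Summits.ValiantsHypothesis.ValiantsHypothesis.Theorems.ChowBorderDepth3ChowBorderBoundStubTranslate
import Summits.ValiantsHypothesis.ValiantsHypothesis.Theorems.ChowBorderDepth3ChowBorderBoundStubInterpolate
import Summits.ValiantsHypothesis.ValiantsHypothesis.Theorems.ChowBorderDepth3ChowBorderBoundStubRescale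
import Summits.ValiantsHypothesis.ValiantsHypothesis.Theorems.ChowBorderDepth3ChowBorderBoundStubGradedOfLocal
import Summits.ValiantsHypothesis.ValiantsHypothesis.Theorems.ChowBorderDepth3ChowBorderBoundFanInTwoRung

/-!
# Skeleton (lead's reshape of the birth skeleton BC3) for crux `ChowBorderDepth3.ChowBorderBound`
# (stmt-ValiantsHypothesis-5936), line `registered` = `vertex-normal-form`

Lead reshape (prover-line-stmt-ValiantsHypothesis-5936-0, 2026-08-17, cycle 1): the birth stub
L `stub_localisation` (size L) is split at the skeleton level into THREE registered stubs whose
composition is proved here (`stub_localisation_of`), so that independent workers can take them: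

* **`stub_translate`** (TRUE; M).  Generic translation.  A border ΣΠΣ expression
  `Σ_{i<r} Π_{j<D} ℓ_ij = ε^q per_n + ε^(q+1) G` (affine `ℓ_ij` over `ℂ[ε]`) becomes, after the
  `ℂ[ε]`-algebra map `x_v ↦ x_v + u_v` for a GENERIC `u ∈ ℂ[ε]^(n²)` (chosen with
  `MvPolynomial.funext` over the infinite domain `ℂ[ε]` so that every non-zero `ℓ_ij` gets the
  non-zero constant term `ℓ_ij(u)`), a weighted sum `Σ_i a_i Π_j (c_ij + L_ij(x))` with ALL
  `c_ij ≠ 0` (`a_i = 0`, `c_ij = 1` for the products that had a zero factor), equal to the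
  TRANSLATE of the border target.
* **`stub_interpolate`** (TRUE; M/L).  Degree-`n` extraction.  From the translated identity,
  Lagrange/Vandermonde interpolation over `D+1` scalings `x ↦ t_k x` (`t_k = k+1 ∈ ℂ`) extracts the
  `x`-degree-`n` homogeneous component of both sides: the left side stays a weighted sum of
  products of affine forms with non-zero constant terms, now `r·(D+1)` of them
  (`finProdFinEquiv`); the right side becomes `ε^q per_n + ε^(q+1) G_n` with `G_n` HOMOGENEOUS of
  degree `n`, because the degree-`n` component of `per_n(x+u)` is `per_n(x)` (translation only
  adds lower-order terms to a form).  If `n > D` the hypothesis is contradictory (compare the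
  coefficient of a permutation monomial), so the conclusion holds vacuously.
* **`stub_rescale`** (TRUE; M/L).  Rescaling and truncated units.  With all `c_ij ≠ 0` and `G`
  homogeneous of degree `n`: write `c_ij = ε^(e_ij) w_ij`, `ε ∤ w_ij`
  (`Polynomial.exists_eq_pow_rootMultiplicity_mul_and_not_dvd`), take `N > max e_ij`, apply
  `x ↦ ε^N x` (right side: `ε^(q+Nn) per_n + ε^(q+1+Nn) G` by homogeneity), and divide factor
  `(i,j)` by `w_ij` using `w̃_ij` with `w_ij w̃_ij ≡ 1 (mod ε^M)`, `M = q + N n + 1`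
  (`IsCoprime` with `ε^M`): `c_ij + ε^N L_ij = ε^(e_ij) w_ij (1 + ε^(N−e_ij) w̃_ij L_ij) + ε^(N+M)·(…)`,
  and the error is absorbed in `G`.  Output: the LOCAL shape `Σ_i a'_i Π_j (1 + m_ij)`, `ε ∣ m_ij`,
  same `r`, same `D`.
* **`stub_gradedOfLocal`** (TRUE; M) — unchanged from birth: grading of a local expression into
  the elementary-symmetric system (`homogeneousComponent_prod_one_add`).
* **`stub_gradedESymBound`** (OPEN — the heart) — unchanged from birth; held by the lead.

All registered stub statements are written UNFOLDED and FULLY QUALIFIED (no skeleton-local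
definition occurs in them), so that a worker's Theorems file can state and prove the registered
signature verbatim with `import Mathlib` + Literature only.  §0 keeps the folded vocabulary
(`HasBorderSPS`, …) for reading; each folded predicate is definitionally the corresponding
unfolded `∃`-block.

Composition `ChowBorderBound_of` (sorry-free): translate ∘ interpolate ∘ rescale gives the birth
localisation `HasBorderSPS n r D → HasLocalBorderSPS n (r(D+1)) D`; then grade (G) and contradict
H at `2c+1` (chasm arithmetic `mul_succ_le_chasm`, tree lemma `chowToThesis_succ_le_pow`).

Disproof used: none exists for this crux (`ledger crux ls stmt-ValiantsHypothesis-5936`: only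
`Lines/birth.{lean,md}`; no `Disproof.lean`, no crux ideas, 2026-08-17).

STATUS after wave 1 (lead, 2026-08-17): T, I, R, G LANDED (p147115, p147715, p147422, p147996) and
are used BY NAME below; the only `sorry` is H.  About H, in the tree:
`FanInTwoRung.stub_gradedESymBound_fanInTwo` (rung `r ≤ 2`, p147309) and the converse transfer
`GradedOfCrux.stub_gradedESymBound_of_crux : ChowBorderBound → H` (p150241) with
`OfGraded.chowBorderBound_iff_graded : ChowBorderBound ↔ H` (p150806) — H is exactly the crux in
normal form; its open content starts at `r = 3` (see `Lines/registered.md`).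
-/

set_option linter.dupNamespace false

noncomputable section

namespace Summit.ValiantsHypothesis.ValiantsHypothesis.Cruxes.ChowBorderBound.Birth

open MvPolynomial
open Literature.Computability.AlgebraicComplexity
open scoped BigOperators Polynomial

/-! ## §0 Vocabulary (folded forms, for reading; each is definitionally its unfolded `∃`-block) -/

/-- The border target `ε^q · per_n + ε^(q+1) · G` over `ℂ[ε]` (`ε = Polynomial.X`), verbatim the
right-hand side of the crux. -/
def borderTarget (n q : ℕ) (G : MvPolynomial (Fin n × Fin n) ℂ[X]) :
    MvPolynomial (Fin n × Fin n) ℂ[X] :=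
  C (Polynomial.X ^ q) * MvPolynomial.map Polynomial.C (perPoly (Fin n) ℂ) +
    C (Polynomial.X ^ (q + 1)) * G

/-- The linear form with coefficient vector `m` (coefficients in `ℂ[ε]`). -/
def linForm {n : ℕ} (m : Fin n × Fin n → ℂ[X]) : MvPolynomial (Fin n × Fin n) ℂ[X] :=
  ∑ v, C (m v) * X v

/-- `e_d` of the `D` linear forms with coefficient vectors `m j`:
`Σ_{A ⊆ [D], |A| = d} Π_{j ∈ A} m_j`. -/
def esymForm {n D : ℕ} (d : ℕ) (m : Fin D → Fin n × Fin n → ℂ[X]) :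
    MvPolynomial (Fin n × Fin n) ℂ[X] :=
  ∑ A ∈ Finset.powersetCard d (Finset.univ : Finset (Fin D)), ∏ j ∈ A, linForm (m j)

/-- **General shape** (the crux's): a border ΣΠΣ expression of `per_n` with `r` products of `D`
affine forms over `ℂ[ε]`. -/
def HasBorderSPS (n r D : ℕ) : Prop :=
  ∃ (q : ℕ) (ℓ : Fin r → Fin D → MvPolynomial (Fin n × Fin n) ℂ[X])
    (G : MvPolynomial (Fin n × Fin n) ℂ[X]),
    (∀ i j, (ℓ i j).totalDegree ≤ 1) ∧ (∑ i, ∏ j, ℓ i j) = borderTarget n q G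

/-- **Translated shape**: weighted products of affine forms with NON-ZERO constant terms, equal to
the translate `x ↦ x + u` (`u ∈ ℂ[ε]^(n²)`) of the border target. -/
def HasTranslatedSPS (n r D : ℕ) : Prop :=
  ∃ (q : ℕ) (u : Fin n × Fin n → ℂ[X]) (a : Fin r → ℂ[X]) (c : Fin r → Fin D → ℂ[X])
    (L : Fin r → Fin D → Fin n × Fin n → ℂ[X]) (G : MvPolynomial (Fin n × Fin n) ℂ[X]),
    (∀ i j, c i j ≠ 0) ∧
      (∑ i, C (a i) * ∏ j, (C (c i j) + linForm (L i j))) =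
        aeval (fun v => X v + C (u v)) (borderTarget n q G)

/-- **Non-degenerate shape**: weighted products of affine forms with non-zero constant terms,
equal to the border target with a HOMOGENEOUS degree-`n` error term `G`. -/
def HasNondegBorderSPS (n r D : ℕ) : Prop :=
  ∃ (q : ℕ) (a : Fin r → ℂ[X]) (c : Fin r → Fin D → ℂ[X])
    (L : Fin r → Fin D → Fin n × Fin n → ℂ[X]) (G : MvPolynomial (Fin n × Fin n) ℂ[X]),
    (∀ i j, c i j ≠ 0) ∧ G.IsHomogeneous n ∧
      (∑ i, C (a i) * ∏ j, (C (c i j) + linForm (L i j))) = borderTarget n q G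

/-- **Local shape** (that of `PolyFanInLocal` / `LocalFanInTwo`): every factor is `1 + m_ij` with
all coefficients of the linear form `m_ij` divisible by `ε`. -/
def HasLocalBorderSPS (n r D : ℕ) : Prop :=
  ∃ (q : ℕ) (a : Fin r → ℂ[X]) (m : Fin r → Fin D → Fin n × Fin n → ℂ[X])
    (G : MvPolynomial (Fin n × Fin n) ℂ[X]),
    (∀ i j v, Polynomial.X ∣ m i j v) ∧
      (∑ i, C (a i) * ∏ j, (1 + linForm (m i j))) = borderTarget n q G

/-- **Graded elementary-symmetric shape**: scalars `a_i(ε)`, linear forms `m'_ij(ε)` and, degree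
by degree, `ε^d · Σ_i a_i e_d(m'_i1, …, m'_iD) = [d = n] ε^q per_n + ε^(q+1) G_d`. -/
def HasGradedESym (n r D : ℕ) : Prop :=
  ∃ (q : ℕ) (a : Fin r → ℂ[X]) (m : Fin r → Fin D → Fin n × Fin n → ℂ[X])
    (G : ℕ → MvPolynomial (Fin n × Fin n) ℂ[X]),
    ∀ d : ℕ, C (Polynomial.X ^ d) * (∑ i, C (a i) * esymForm d (m i)) =
      (if d = n then C (Polynomial.X ^ q) * MvPolynomial.map Polynomial.C (perPoly (Fin n) ℂ)
        else 0) + C (Polynomial.X ^ (q + 1)) * G d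

/-! ## §1 The stub statements as named propositions (UNFOLDED, fully qualified)

(The last name component of each `Sig.stub_*` is the registered stub's name, so that the
composition `ChowBorderBound_of` takes the declared stubs BY NAME.) -/

namespace Sig

/-- **Stub T** — generic translation (true; M). -/
def stub_translate : Prop :=
  ∀ n r D : ℕ,
    (∃ (q : ℕ) (ℓ : Fin r → Fin D → MvPolynomial (Fin n × Fin n) (Polynomial ℂ))
        (G : MvPolynomial (Fin n × Fin n) (Polynomial ℂ)),
        (∀ i j, (ℓ i j).totalDegree ≤ 1) ∧
        (∑ i, ∏ j, ℓ i j) =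
          MvPolynomial.C (Polynomial.X ^ q) *
              MvPolynomial.map Polynomial.C
                (Literature.Computability.AlgebraicComplexity.perPoly (Fin n) ℂ) +
            MvPolynomial.C (Polynomial.X ^ (q + 1)) * G) →
    ∃ (q : ℕ) (u : Fin n × Fin n → Polynomial ℂ) (a : Fin r → Polynomial ℂ)
      (c : Fin r → Fin D → Polynomial ℂ) (L : Fin r → Fin D → Fin n × Fin n → Polynomial ℂ)
      (G : MvPolynomial (Fin n × Fin n) (Polynomial ℂ)),
      (∀ i j, c i j ≠ 0) ∧
      (∑ i, MvPolynomial.C (a i) *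
          ∏ j, (MvPolynomial.C (c i j) + ∑ v, MvPolynomial.C (L i j v) * MvPolynomial.X v)) =
        MvPolynomial.aeval (fun v => MvPolynomial.X v + MvPolynomial.C (u v))
          (MvPolynomial.C (Polynomial.X ^ q) *
              MvPolynomial.map Polynomial.C
                (Literature.Computability.AlgebraicComplexity.perPoly (Fin n) ℂ) +
            MvPolynomial.C (Polynomial.X ^ (q + 1)) * G)

/-- **Stub I** — degree-`n` extraction by interpolation over `D+1` scalings (true; M/L). -/
def stub_interpolate : Prop :=
  ∀ n r D : ℕ,
    (∃ (q : ℕ) (u : Fin n × Fin n → Polynomial ℂ) (a : Fin r → Polynomial ℂ)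
        (c : Fin r → Fin D → Polynomial ℂ) (L : Fin r → Fin D → Fin n × Fin n → Polynomial ℂ)
        (G : MvPolynomial (Fin n × Fin n) (Polynomial ℂ)),
        (∀ i j, c i j ≠ 0) ∧
        (∑ i, MvPolynomial.C (a i) *
            ∏ j, (MvPolynomial.C (c i j) + ∑ v, MvPolynomial.C (L i j v) * MvPolynomial.X v)) =
          MvPolynomial.aeval (fun v => MvPolynomial.X v + MvPolynomial.C (u v))
            (MvPolynomial.C (Polynomial.X ^ q) *
                MvPolynomial.map Polynomial.C
                  (Literature.Computability.AlgebraicComplexity.perPoly (Fin n) ℂ) +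
              MvPolynomial.C (Polynomial.X ^ (q + 1)) * G)) →
    ∃ (q : ℕ) (a : Fin (r * (D + 1)) → Polynomial ℂ)
      (c : Fin (r * (D + 1)) → Fin D → Polynomial ℂ)
      (L : Fin (r * (D + 1)) → Fin D → Fin n × Fin n → Polynomial ℂ)
      (G : MvPolynomial (Fin n × Fin n) (Polynomial ℂ)),
      (∀ i j, c i j ≠ 0) ∧ G.IsHomogeneous n ∧
      (∑ i, MvPolynomial.C (a i) *
          ∏ j, (MvPolynomial.C (c i j) + ∑ v, MvPolynomial.C (L i j v) * MvPolynomial.X v)) =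
        MvPolynomial.C (Polynomial.X ^ q) *
            MvPolynomial.map Polynomial.C
              (Literature.Computability.AlgebraicComplexity.perPoly (Fin n) ℂ) +
          MvPolynomial.C (Polynomial.X ^ (q + 1)) * G

/-- **Stub R** — rescaling `x ↦ ε^N x` and truncated units (true; M/L). -/
def stub_rescale : Prop :=
  ∀ n r D : ℕ,
    (∃ (q : ℕ) (a : Fin r → Polynomial ℂ) (c : Fin r → Fin D → Polynomial ℂ)
        (L : Fin r → Fin D → Fin n × Fin n → Polynomial ℂ)
        (G : MvPolynomial (Fin n × Fin n) (Polynomial ℂ)),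
        (∀ i j, c i j ≠ 0) ∧ G.IsHomogeneous n ∧
        (∑ i, MvPolynomial.C (a i) *
            ∏ j, (MvPolynomial.C (c i j) + ∑ v, MvPolynomial.C (L i j v) * MvPolynomial.X v)) =
          MvPolynomial.C (Polynomial.X ^ q) *
              MvPolynomial.map Polynomial.C
                (Literature.Computability.AlgebraicComplexity.perPoly (Fin n) ℂ) +
            MvPolynomial.C (Polynomial.X ^ (q + 1)) * G) →
    ∃ (q : ℕ) (a : Fin r → Polynomial ℂ) (m : Fin r → Fin D → Fin n × Fin n → Polynomial ℂ)
      (G : MvPolynomial (Fin n × Fin n) (Polynomial ℂ)),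
      (∀ i j v, Polynomial.X ∣ m i j v) ∧
      (∑ i, MvPolynomial.C (a i) *
          ∏ j, (1 + ∑ v, MvPolynomial.C (m i j v) * MvPolynomial.X v)) =
        MvPolynomial.C (Polynomial.X ^ q) *
            MvPolynomial.map Polynomial.C
              (Literature.Computability.AlgebraicComplexity.perPoly (Fin n) ℂ) +
          MvPolynomial.C (Polynomial.X ^ (q + 1)) * G

/-- **Stub G** — grading of a local expression into the elementary-symmetric system (true; M). -/
def stub_gradedOfLocal : Prop :=
  ∀ n r D : ℕ,
    (∃ (q : ℕ) (a : Fin r → Polynomial ℂ) (m : Fin r → Fin D → Fin n × Fin n → Polynomial ℂ)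
        (G : MvPolynomial (Fin n × Fin n) (Polynomial ℂ)),
        (∀ i j v, Polynomial.X ∣ m i j v) ∧
        (∑ i, MvPolynomial.C (a i) *
            ∏ j, (1 + ∑ v, MvPolynomial.C (m i j v) * MvPolynomial.X v)) =
          MvPolynomial.C (Polynomial.X ^ q) *
              MvPolynomial.map Polynomial.C
                (Literature.Computability.AlgebraicComplexity.perPoly (Fin n) ℂ) +
            MvPolynomial.C (Polynomial.X ^ (q + 1)) * G) →
    ∃ (q : ℕ) (a : Fin r → Polynomial ℂ) (m : Fin r → Fin D → Fin n × Fin n → Polynomial ℂ)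
      (G : ℕ → MvPolynomial (Fin n × Fin n) (Polynomial ℂ)),
      ∀ d : ℕ, MvPolynomial.C (Polynomial.X ^ d) *
          (∑ i, MvPolynomial.C (a i) *
            ∑ A ∈ Finset.powersetCard d (Finset.univ : Finset (Fin D)),
              ∏ j ∈ A, ∑ v, MvPolynomial.C (m i j v) * MvPolynomial.X v) =
        (if d = n then
            MvPolynomial.C (Polynomial.X ^ q) *
              MvPolynomial.map Polynomial.C
                (Literature.Computability.AlgebraicComplexity.perPoly (Fin n) ℂ)
          else 0) +
          MvPolynomial.C (Polynomial.X ^ (q + 1)) * G d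

/-- **Stub H** — no graded elementary-symmetric system in the chasm range (OPEN; the heart). -/
def stub_gradedESymBound : Prop :=
  ∀ c : ℕ, ∃ n₀ : ℕ, ∀ n ≥ n₀, ∀ r D : ℕ, r ≤ (n + 2) ^ (c * Nat.sqrt n + c) →
    D ≤ (n + 2) ^ (c * Nat.sqrt n + c) →
    ¬ ∃ (q : ℕ) (a : Fin r → Polynomial ℂ) (m : Fin r → Fin D → Fin n × Fin n → Polynomial ℂ)
        (G : ℕ → MvPolynomial (Fin n × Fin n) (Polynomial ℂ)),
        ∀ d : ℕ, MvPolynomial.C (Polynomial.X ^ d) *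
            (∑ i, MvPolynomial.C (a i) *
              ∑ A ∈ Finset.powersetCard d (Finset.univ : Finset (Fin D)),
                ∏ j ∈ A, ∑ v, MvPolynomial.C (m i j v) * MvPolynomial.X v) =
          (if d = n then
              MvPolynomial.C (Polynomial.X ^ q) *
                MvPolynomial.map Polynomial.C
                  (Literature.Computability.AlgebraicComplexity.perPoly (Fin n) ℂ)
            else 0) +
            MvPolynomial.C (Polynomial.X ^ (q + 1)) * G d

end Sig

/-! ## §2 The registered stubs (statements spelled out; `sorry` lives only here) -/

/-- **Stub T (registered)** — GENERIC TRANSLATION: a border ΣΠΣ expression of `per_n` becomes,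
after `x ↦ x + u` for a generic `u ∈ ℂ[ε]^(n²)`, a weighted sum of `r` products of `D` affine
forms all of whose constant terms are non-zero, equal to the translate of the border target.
Size M. -/
theorem stub_translate :
    ∀ n r D : ℕ,
    (∃ (q : ℕ) (ℓ : Fin r → Fin D → MvPolynomial (Fin n × Fin n) (Polynomial ℂ))
        (G : MvPolynomial (Fin n × Fin n) (Polynomial ℂ)),
        (∀ i j, (ℓ i j).totalDegree ≤ 1) ∧
        (∑ i, ∏ j, ℓ i j) =
          MvPolynomial.C (Polynomial.X ^ q) *
              MvPolynomial.map Polynomial.C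
                (Literature.Computability.AlgebraicComplexity.perPoly (Fin n) ℂ) +
            MvPolynomial.C (Polynomial.X ^ (q + 1)) * G) →
    ∃ (q : ℕ) (u : Fin n × Fin n → Polynomial ℂ) (a : Fin r → Polynomial ℂ)
      (c : Fin r → Fin D → Polynomial ℂ) (L : Fin r → Fin D → Fin n × Fin n → Polynomial ℂ)
      (G : MvPolynomial (Fin n × Fin n) (Polynomial ℂ)),
      (∀ i j, c i j ≠ 0) ∧
      (∑ i, MvPolynomial.C (a i) *
          ∏ j, (MvPolynomial.C (c i j) + ∑ v, MvPolynomial.C (L i j v) * MvPolynomial.X v)) =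
        MvPolynomial.aeval (fun v => MvPolynomial.X v + MvPolynomial.C (u v))
          (MvPolynomial.C (Polynomial.X ^ q) *
              MvPolynomial.map Polynomial.C
                (Literature.Computability.AlgebraicComplexity.perPoly (Fin n) ℂ) +
            MvPolynomial.C (Polynomial.X ^ (q + 1)) * G) :=
  -- LANDED (wave 1, p147115): stub-worker file `Theorems/ChowBorderDepth3ChowBorderBoundStubTranslate.lean`
  Summit.ValiantsHypothesis.ValiantsHypothesis.Theorems.ChowBorderBound.Translate.stub_translate

/-- **Stub I (registered)** — DEGREE-`n` EXTRACTION: from the translated identity, interpolation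
over `D+1` scalings `x ↦ t_k x` yields `r·(D+1)` weighted products of affine forms with non-zero
constant terms summing to `ε^q per_n + ε^(q+1) G` with `G` homogeneous of degree `n`.
Size M/L. -/
theorem stub_interpolate :
    ∀ n r D : ℕ,
    (∃ (q : ℕ) (u : Fin n × Fin n → Polynomial ℂ) (a : Fin r → Polynomial ℂ)
        (c : Fin r → Fin D → Polynomial ℂ) (L : Fin r → Fin D → Fin n × Fin n → Polynomial ℂ)
        (G : MvPolynomial (Fin n × Fin n) (Polynomial ℂ)),
        (∀ i j, c i j ≠ 0) ∧
        (∑ i, MvPolynomial.C (a i) *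
            ∏ j, (MvPolynomial.C (c i j) + ∑ v, MvPolynomial.C (L i j v) * MvPolynomial.X v)) =
          MvPolynomial.aeval (fun v => MvPolynomial.X v + MvPolynomial.C (u v))
            (MvPolynomial.C (Polynomial.X ^ q) *
                MvPolynomial.map Polynomial.C
                  (Literature.Computability.AlgebraicComplexity.perPoly (Fin n) ℂ) +
              MvPolynomial.C (Polynomial.X ^ (q + 1)) * G)) →
    ∃ (q : ℕ) (a : Fin (r * (D + 1)) → Polynomial ℂ)
      (c : Fin (r * (D + 1)) → Fin D → Polynomial ℂ)
      (L : Fin (r * (D + 1)) → Fin D → Fin n × Fin n → Polynomial ℂ)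
      (G : MvPolynomial (Fin n × Fin n) (Polynomial ℂ)),
      (∀ i j, c i j ≠ 0) ∧ G.IsHomogeneous n ∧
      (∑ i, MvPolynomial.C (a i) *
          ∏ j, (MvPolynomial.C (c i j) + ∑ v, MvPolynomial.C (L i j v) * MvPolynomial.X v)) =
        MvPolynomial.C (Polynomial.X ^ q) *
            MvPolynomial.map Polynomial.C
              (Literature.Computability.AlgebraicComplexity.perPoly (Fin n) ℂ) +
          MvPolynomial.C (Polynomial.X ^ (q + 1)) * G :=
  -- LANDED (wave 1): stub-worker file `Theorems/ChowBorderDepth3ChowBorderBoundStubInterpolate.lean`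
  Summit.ValiantsHypothesis.ValiantsHypothesis.Theorems.ChowBorderBound.Interpolate.stub_interpolate

/-- **Stub R (registered)** — RESCALING AND TRUNCATED UNITS: a non-degenerate expression (all
constant terms non-zero, homogeneous error term) becomes a LOCAL one (`Π_j (1 + m_ij)`, `ε ∣ m_ij`)
with the same `r` and `D`, via `x ↦ ε^N x` and inverses of the unit parts of the constant terms
truncated modulo `ε^(q+Nn+1)`.  Size M/L. -/
theorem stub_rescale :
    ∀ n r D : ℕ,
    (∃ (q : ℕ) (a : Fin r → Polynomial ℂ) (c : Fin r → Fin D → Polynomial ℂ)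
        (L : Fin r → Fin D → Fin n × Fin n → Polynomial ℂ)
        (G : MvPolynomial (Fin n × Fin n) (Polynomial ℂ)),
        (∀ i j, c i j ≠ 0) ∧ G.IsHomogeneous n ∧
        (∑ i, MvPolynomial.C (a i) *
            ∏ j, (MvPolynomial.C (c i j) + ∑ v, MvPolynomial.C (L i j v) * MvPolynomial.X v)) =
          MvPolynomial.C (Polynomial.X ^ q) *
              MvPolynomial.map Polynomial.C
                (Literature.Computability.AlgebraicComplexity.perPoly (Fin n) ℂ) +
            MvPolynomial.C (Polynomial.X ^ (q + 1)) * G) →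
    ∃ (q : ℕ) (a : Fin r → Polynomial ℂ) (m : Fin r → Fin D → Fin n × Fin n → Polynomial ℂ)
      (G : MvPolynomial (Fin n × Fin n) (Polynomial ℂ)),
      (∀ i j v, Polynomial.X ∣ m i j v) ∧
      (∑ i, MvPolynomial.C (a i) *
          ∏ j, (1 + ∑ v, MvPolynomial.C (m i j v) * MvPolynomial.X v)) =
        MvPolynomial.C (Polynomial.X ^ q) *
            MvPolynomial.map Polynomial.C
              (Literature.Computability.AlgebraicComplexity.perPoly (Fin n) ℂ) +
          MvPolynomial.C (Polynomial.X ^ (q + 1)) * G :=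
  -- LANDED (wave 1, p147422): stub-worker file `Theorems/ChowBorderDepth3ChowBorderBoundStubRescale.lean`
  Summit.ValiantsHypothesis.ValiantsHypothesis.Theorems.ChowBorderBound.Rescale.stub_rescale

/-- **Stub G (registered)** — GRADING: a local border expression with data `(q, a, m = ε m')`
gives the graded elementary-symmetric system for `(q, a, m')`: the `x`-degree-`d` component of
`Σ_i a_i Π_j (1 + ε m'_ij)` is `ε^d Σ_i a_i e_d(m'_i)` (`homogeneousComponent_prod_one_add`),
that of the target is `[d = n] ε^q per_n + ε^(q+1) G_d`.  Size M. -/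
theorem stub_gradedOfLocal :
    ∀ n r D : ℕ,
    (∃ (q : ℕ) (a : Fin r → Polynomial ℂ) (m : Fin r → Fin D → Fin n × Fin n → Polynomial ℂ)
        (G : MvPolynomial (Fin n × Fin n) (Polynomial ℂ)),
        (∀ i j v, Polynomial.X ∣ m i j v) ∧
        (∑ i, MvPolynomial.C (a i) *
            ∏ j, (1 + ∑ v, MvPolynomial.C (m i j v) * MvPolynomial.X v)) =
          MvPolynomial.C (Polynomial.X ^ q) *
              MvPolynomial.map Polynomial.C
                (Literature.Computability.AlgebraicComplexity.perPoly (Fin n) ℂ) +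
            MvPolynomial.C (Polynomial.X ^ (q + 1)) * G) →
    ∃ (q : ℕ) (a : Fin r → Polynomial ℂ) (m : Fin r → Fin D → Fin n × Fin n → Polynomial ℂ)
      (G : ℕ → MvPolynomial (Fin n × Fin n) (Polynomial ℂ)),
      ∀ d : ℕ, MvPolynomial.C (Polynomial.X ^ d) *
          (∑ i, MvPolynomial.C (a i) *
            ∑ A ∈ Finset.powersetCard d (Finset.univ : Finset (Fin D)),
              ∏ j ∈ A, ∑ v, MvPolynomial.C (m i j v) * MvPolynomial.X v) =
        (if d = n then
            MvPolynomial.C (Polynomial.X ^ q) *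
              MvPolynomial.map Polynomial.C
                (Literature.Computability.AlgebraicComplexity.perPoly (Fin n) ℂ)
          else 0) +
          MvPolynomial.C (Polynomial.X ^ (q + 1)) * G d :=
  -- LANDED (wave 1): stub-worker file `Theorems/ChowBorderDepth3ChowBorderBoundStubGradedOfLocal.lean`
  Summit.ValiantsHypothesis.ValiantsHypothesis.Theorems.ChowBorderBound.GradedOfLocal.stub_gradedOfLocal

/-- **Stub H (registered)** — THE HEART (open): for every `c`, for all large `n` and all
`r, D ≤ (n+2)^(c⌊√n⌋+c)`, there are no scalars `a_i(ε)`, linear forms `m'_ij(ε)` (`i < r`,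
`j < D`) and `q` with `ε^d Σ_i a_i e_d(m'_i1, …, m'_iD) ≡ [d = n] ε^q per_n (mod ε^(q+1))` for
every degree `d`.  Rungs: `r = 2` is `LocalFanInTwo` (proved), `r ≤ n^k + k` is `PolyFanInLocal`. -/
theorem stub_gradedESymBound :
    ∀ c : ℕ, ∃ n₀ : ℕ, ∀ n ≥ n₀, ∀ r D : ℕ, r ≤ (n + 2) ^ (c * Nat.sqrt n + c) →
    D ≤ (n + 2) ^ (c * Nat.sqrt n + c) →
    ¬ ∃ (q : ℕ) (a : Fin r → Polynomial ℂ) (m : Fin r → Fin D → Fin n × Fin n → Polynomial ℂ)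
        (G : ℕ → MvPolynomial (Fin n × Fin n) (Polynomial ℂ)),
        ∀ d : ℕ, MvPolynomial.C (Polynomial.X ^ d) *
            (∑ i, MvPolynomial.C (a i) *
              ∑ A ∈ Finset.powersetCard d (Finset.univ : Finset (Fin D)),
                ∏ j ∈ A, ∑ v, MvPolynomial.C (m i j v) * MvPolynomial.X v) =
          (if d = n then
              MvPolynomial.C (Polynomial.X ^ q) *
                MvPolynomial.map Polynomial.C
                  (Literature.Computability.AlgebraicComplexity.perPoly (Fin n) ℂ)
            else 0) +
            MvPolynomial.C (Polynomial.X ^ (q + 1)) * G d := by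
  sorry

/-! ## §3 Composition (sorry-free) and calibration -/

/-- The three localisation stubs compose to the birth skeleton's localisation step
`HasBorderSPS n r D → HasLocalBorderSPS n (r·(D+1)) D` (all predicates unfold definitionally to
the stubs' `∃`-blocks). -/
theorem stub_localisation_of (hT : Sig.stub_translate) (hI : Sig.stub_interpolate)
    (hR : Sig.stub_rescale) :
    ∀ n r D : ℕ, HasBorderSPS n r D → HasLocalBorderSPS n (r * (D + 1)) D :=
  fun n r D h => hR n (r * (D + 1)) D (hI n r D (hT n r D h))

/-- Grading, folded: `HasLocalBorderSPS n r D → HasGradedESym n r D` is stub G. -/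
theorem hasGradedESym_of_local (hG : Sig.stub_gradedOfLocal) :
    ∀ n r D : ℕ, HasLocalBorderSPS n r D → HasGradedESym n r D :=
  fun n r D h => hG n r D h

/-- Arithmetic of the chasm range: `r, D ≤ (n+2)^(c⌊√n⌋+c)` gives
`r·(D+1) ≤ (n+2)^((2c+1)⌊√n⌋+(2c+1))`. -/
theorem mul_succ_le_chasm {n c r D : ℕ} (hr : r ≤ (n + 2) ^ (c * Nat.sqrt n + c))
    (hD : D ≤ (n + 2) ^ (c * Nat.sqrt n + c)) :
    r * (D + 1) ≤ (n + 2) ^ ((2 * c + 1) * Nat.sqrt n + (2 * c + 1)) := by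
  have hD1 : D + 1 ≤ (n + 2) ^ ((c + 1) * Nat.sqrt n + (c + 1)) :=
    Summit.ValiantsHypothesis.ValiantsHypothesis.Theorems.chowToThesis_succ_le_pow hD
  calc r * (D + 1)
      ≤ (n + 2) ^ (c * Nat.sqrt n + c) * (n + 2) ^ ((c + 1) * Nat.sqrt n + (c + 1)) :=
        Nat.mul_le_mul hr hD1
    _ = (n + 2) ^ ((2 * c + 1) * Nat.sqrt n + (2 * c + 1)) := by
        rw [← pow_add]; congr 1; ring

/-- Monotonicity of the chasm bound in `c`. -/
theorem chasm_mono {n c : ℕ} :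
    (n + 2) ^ (c * Nat.sqrt n + c) ≤ (n + 2) ^ ((2 * c + 1) * Nat.sqrt n + (2 * c + 1)) :=
  Nat.pow_le_pow_right (by omega) (by nlinarith [Nat.zero_le (Nat.sqrt n), Nat.zero_le c])

/-- **The line closes the crux**: translation (T) + interpolation (I) + rescaling (R) — the
localisation at the vertex — then grading (G) and the graded bound (H) give
`ChowBorderDepth3.ChowBorderBound`, at threshold `n₀(2c+1) + 1`. -/
theorem ChowBorderBound_of :
    Sig.stub_translate → Sig.stub_interpolate → Sig.stub_rescale → Sig.stub_gradedOfLocal →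
      Sig.stub_gradedESymBound →
      Summit.ValiantsHypothesis.ValiantsHypothesis.Theses.ChowBorderDepth3.ChowBorderBound := by
  intro hT hI hR hG hH c
  obtain ⟨n₀, hn₀⟩ := hH (2 * c + 1)
  refine ⟨n₀ + 1, fun n hn r D hr hD hex => ?_⟩
  have hsps : HasBorderSPS n r D := by
    obtain ⟨q, ℓ, G, hdeg, hsum⟩ := hex
    exact ⟨q, ℓ, G, hdeg, hsum⟩
  have hloc : HasLocalBorderSPS n (r * (D + 1)) D := stub_localisation_of hT hI hR n r D hsps
  have hgr : HasGradedESym n (r * (D + 1)) D := hasGradedESym_of_local hG n (r * (D + 1)) D hloc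
  exact hn₀ n (by omega) (r * (D + 1)) D (mul_succ_le_chasm hr hD) (hD.trans chasm_mono) hgr

/-- **The skeleton**: `ChowBorderDepth3.ChowBorderBound` BY NAME, modulo exactly the five
registered stubs. -/
theorem ChowBorderBound_proof :
    Summit.ValiantsHypothesis.ValiantsHypothesis.Theses.ChowBorderDepth3.ChowBorderBound :=
  ChowBorderBound_of stub_translate stub_interpolate stub_rescale stub_gradedOfLocal
    stub_gradedESymBound

/-- **Calibration (proved, not a stub)**: Ryser's formula is a local border expression of `per_n`
with `2^n` summands and `D = n` factors (tree theorem `exists_local_ryser_perPoly`), so the local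
shape is inhabited for `per_n` just above the chasm range and stub H is not vacuously true. -/
theorem hasLocalBorderSPS_ryser (n : ℕ) : HasLocalBorderSPS n (2 ^ n) n := by
  obtain ⟨q, a, m, G, hm, hsum⟩ :=
    Summit.ValiantsHypothesis.ValiantsHypothesis.Theorems.exists_local_ryser_perPoly n
  exact ⟨q, a, m, G, hm, hsum⟩

/-- **Calibration of the graded shape (proved)** at `n = 1`, `r = 2`, `D = 1` (`per_1 = x`):
the local identity `(1 + εx) − 1 = ε·x` graded — `a = (1, −1)`, `m'_0 = x`, `m'_1 = 0`, `q = 1`,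
`G = 0`: degree `0` reads `1 − 1 = 0`, degree `1` reads `ε·x = ε·per_1`, degrees `≥ 2` are empty.
So `HasGradedESym` computes and is inhabited in kind (it is refutable only through the size bounds). -/
theorem hasGradedESym_one : HasGradedESym 1 2 1 := by
  classical
  refine ⟨1, ![1, -1], ![fun _ _ => 1, fun _ _ => 0], fun _ => 0, fun d => ?_⟩
  have hper : MvPolynomial.map Polynomial.C (perPoly (Fin 1) ℂ) =
      (X ((0 : Fin 1), (0 : Fin 1)) : MvPolynomial (Fin 1 × Fin 1) ℂ[X]) := by
    rw [map_perPoly]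
    simp [perPoly, Matrix.permanent, Matrix.mvPolynomialX]
  have hlin1 : linForm (fun _ : Fin 1 × Fin 1 => (1 : ℂ[X])) =
      (X ((0 : Fin 1), (0 : Fin 1)) : MvPolynomial (Fin 1 × Fin 1) ℂ[X]) := by
    simp only [linForm, Fintype.sum_prod_type, Fin.sum_univ_one, map_one, one_mul]
  have hlin0 : linForm (fun _ : Fin 1 × Fin 1 => (0 : ℂ[X])) = 0 := by simp [linForm]
  rcases Nat.lt_trichotomy d 1 with hd | rfl | hd
  · obtain rfl : d = 0 := by omega
    simp [esymForm]
  · have h1' : Finset.powersetCard 1 ({0} : Finset (Fin 1)) = {{0}} := by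
      simpa using Finset.powersetCard_self ({0} : Finset (Fin 1))
    simp [esymForm, hlin1, hlin0, hper, h1']
  · have h2' : Finset.powersetCard d ({0} : Finset (Fin 1)) = ∅ :=
      Finset.powersetCard_eq_empty.2 (by simpa using hd)
    simp [esymForm, h2', show d ≠ 1 by omega]

end Summit.ValiantsHypothesis.ValiantsHypothesis.Cruxes.ChowBorderBound.Birth

end
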